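import Literature.Topology.FourManifolds.BandSumConcordanceLeftProofs
import HarnessLib

/-!
# Concordance of connected sums, normal position: the connected sum of concordances from
# Schubert's theorem in normal position alone

Topic `Literature/Topology/FourManifolds`; sequel of `BandSumConcordanceLeftProofs.lean` in the
proof programme of the named fact
`Literature.Topology.FourManifolds.Knot.exists_isConnectedSum_isConcordant`
(`BandSumConcordance.lean`: if `K₁ ~ K₁'` and `K₂ ~ K₂'` are concordant then *some* connected sum
`K₁ # K₂` is concordant to *some* connected sum `K₁' # K₂'`; Fox–Milnor (1966), §1; Livingston
(2005), Thm. 2.2). The tree reduces it to Schubert's uniqueness of `#` for *arbitrary*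
presentations (`exists_isConnectedSum_isConcordant_of_schubert`, hypothesis
`Knot.IsConnectedSum.isIsotopic`), whose own decomposition (`ConnectedSumNormalForm.lean`) needs
the Schoenflies theorem in `𝕊³` to bring an arbitrary splitting sphere to the equator. This file
removes the Schoenflies theorem from the dependencies of the fact: the witnesses the carrying
construction produces are *already* obtained from presentations in normal position
(`Knot.IsNormalConnectedSum`: first summand in the open northern hemisphere, second in the open
southern one, band crossing the equator in its middle segment) — this is how
`KnotPiece.InTube.isConnectedSum_of_transport` (`BandSumNormalTransport.lean`) proves they are
connected sums — so only **Schubert's theorem in normal position**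
(`Knot.Schubert1949_normalPosition`, named fact of `ConnectedSumNormalForm.lean`; Cromwell (2004),
§4.6) is needed to identify the two witnesses of `K₁' # K₂` at the junction of the chain
`K₁ # K₂ ~ K₁' # K₂ ≅ K₁' # K₂ ~ K₁' # K₂'`. Everything here is proved:

* `KnotPiece.InTube.exists_isNormalConnectedSum_of_transport` — the transport theorem with its
  normal presentation exposed: `Knew ≅ K₀` with `IsNormalConnectedSum Kend Kn K₀` (same proof as
  `isConnectedSum_of_transport`, which only recorded `IsConnectedSum Kend Kn Knew`);
* `IsConicalConcordance.exists_isNormalConnectedSum_isConcordant_of_model`,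
  `IsConicalConcordance.exists_isNormalConnectedSum_isConcordant` — the carrying construction
  (`exists_isConnectedSum_isConcordant_of_model`, `exists_isConnectedSum_isConcordant` of
  `BandSumConcordanceLeftProofs.lean`, same choices of height, frame, scale and collar) with
  normally presented ends (the isotopies to the normal copies are absorbed into the concordance
  by `IsConcordant.of_isIsotopic_holds`);
* `Knot.exists_isNormalConnectedSum_isConcordant_left/right` — the one-sided facts with normal
  presentations; `Knot.IsNormalConnectedSum.swap` (exchange of the summands: half-turn of the
  band square, `BandData.exists_halfTurn`, followed by the half-turn `rot_π` of `𝕊³`),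
  `Knot.IsNormalConnectedSum.of_isIsotopic` (invariance under isotopy of the factors);
* `Knot.IsNormalConnectedSum.isIsotopic_of_normalPosition` — two normal presentations with
  isotopic summands give isotopic knots, granted `Schubert1949_normalPosition` (match the
  summands by the knots-in-a-ball theorem, `IsNormalConnectedSum.exists_bandData_eq`);
* **`Knot.exists_isConnectedSum_isConcordant_of_normalPosition`** — the named fact from
  `Schubert1949_normalPosition` alone.

## References

* R. H. Fox, J. W. Milnor, *Singularities of 2-spheres in 4-space and cobordism of knots*, Osaka
  J. Math. 3 (1966), 257–267, §1. [FoxMilnor1966]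
* C. Livingston, *A survey of classical knot concordance*, Handbook of Knot Theory (2005), §2.1,
  Thm. 2.2 (held: arXiv math/0307077, p. 3). [Livingston2005]
* P. R. Cromwell, *Knots and Links* (2004), §4.6 (products in normal position). [Cromwell2004]

## Design notes

No statement of another file is modified; no named fact is introduced; no `sorry`. The proofs
of the first three theorems repeat those of `BandSumNormalTransport.lean` /
`BandSumConcordanceLeftProofs.lean` verbatim up to their last lines (the landed theorems export
only `IsConnectedSum`, from which the normal presentation cannot be recovered; files are
append-only). No local notation is declared: the model spaces `EuclideanSpace ℝ (Fin n)` and the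
spheres `sphere 0 1` are written out.
-/

open Set Function Metric
open scoped Topology ContDiff Manifold RealInnerProductSpace

noncomputable section

namespace Literature.Topology.FourManifolds

/-! ### Transport to normal position, with the presentation exposed -/

namespace BandFoliation.KnotPiece.InTube

open KnotsInBall Knot.IsConicalConcordance SphereEmbedding

variable {C : ChartData} {D : SegData C} {P : KnotPiece C D} {η ε : ℝ} {E : EndFrame η ε}
  {Kend tiny Knew : Knot}

/-- **Transport of a band sum in an end frame to normal position (presentation exposed).** Under
the hypotheses of `isConnectedSum_of_transport` (band-sum configuration `h` of `Knew` from `Kend`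
and `tiny` in the end frame `E`; ambient isotopy `Θ` reading as `cS ∘ T` on `B̄(0, ρ')` in the
chart `ψ`; `tiny = cS ∘ T ∘ ψ ∘ Kn`; the end knot off `cS (T (B̄(0, ρ')))`; the band meeting the
model sphere in its middle line), the knot `Knew` is isotopic to a knot `K₀ = Φ ∘ Knew`,
`Φ = rot_π ∘ Λ₁⁻¹ ∘ Θ₁⁻¹`, carrying a normal presentation as a connected sum of `Kend` and `Kn`
(`Knot.IsNormalConnectedSum`). Same proof as `isConnectedSum_of_transport`, whose conclusion
kept only `IsConnectedSum Kend Kn Knew`. Cromwell (2004), §4.6. [folklore] -/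
theorem exists_isNormalConnectedSum_of_transport (h : P.InTube E Kend tiny Knew) {Kn : Knot}
    (hKn : ∀ y, Kn y ≠ southPole) (T : EuclideanSpace ℝ (Fin 3) → EuclideanSpace ℝ (Fin 3)) {ρ' : ℝ} (hρ' : 0 < ρ')
    (Θ : AmbientIsotopy (𝓡 3) (sphere (0 : EuclideanSpace ℝ (Fin 4)) 1))
    (hΘ : ∀ z ∈ closedBall (0 : EuclideanSpace ℝ (Fin 3)) ρ', Θ.toFun 1 (psi.symm z) = E.cS (T z))
    (hT : MapsTo T (closedBall (0 : EuclideanSpace ℝ (Fin 3)) ρ') (region 0 η ε))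
    (htinyT : ∀ y, tiny y = E.cS (T (psi (Kn y))))
    (hKnb : ∀ y, psi (Kn y) ∈ ball (0 : EuclideanSpace ℝ (Fin 3)) ρ')
    (hKend : ∀ y, ∀ z ∈ closedBall (0 : EuclideanSpace ℝ (Fin 3)) ρ', Kend y ≠ E.cS (T z))
    (hcirc : ∀ x ∈ squareNhd C.δ, (C.B x ∈ T '' sphere (0 : EuclideanSpace ℝ (Fin 3)) ρ' ↔ x 0 = 2⁻¹)) :
    ∃ K₀ : Knot, Knew.IsIsotopic K₀ ∧ Knot.IsNormalConnectedSum Kend Kn K₀ := by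
  have h2ρ : 0 < 2 / ρ' := by positivity
  -- the homothety isotopy and its transport along `ψ`
  obtain ⟨Λ, hΛ, R, hR⟩ := exists_ambientIsotopy_smul (κ := ρ' / 2) (by positivity) 2
  set Λs := Λ.alongChart (φ := psi) contMDiffOn_psi contMDiff_psi_symm psi_target hR with hΛs
  have hΛs_apply : ∀ y : sphere (0 : EuclideanSpace ℝ (Fin 4)) 1, y ≠ southPole →
      Λs.toFun 1 y = psi.symm (Λ.toFun 1 (psi y)) := fun y hy ↦ by
    rw [hΛs, AmbientIsotopy.alongChart_toFun, chartTransport_of_mem _ (mem_psi_source hy)]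
  set ΘD := Θ.toDiffeomorph 1 with hΘD
  set ΛD := Λs.toDiffeomorph 1 with hΛD
  set Φ : sphere (0 : EuclideanSpace ℝ (Fin 4)) 1 ≃ₘ⟮𝓡 3, 𝓡 3⟯ sphere (0 : EuclideanSpace ℝ (Fin 4)) 1 :=
    (ΘD.symm.trans ΛD.symm).trans halfTurn with hΦ
  have hΦ_apply : ∀ y, Φ y = halfTurn (ΛD.symm (ΘD.symm y)) := fun y ↦ rfl
  -- (K1) the composite `Θ₁ ∘ Λ₁ ∘ ψ⁻¹ ∘ (2/ρ')` is `cS ∘ T` on the closed ball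
  have key : ∀ z ∈ closedBall (0 : EuclideanSpace ℝ (Fin 3)) ρ',
      ΘD (ΛD (psi.symm ((2 / ρ') • z))) = E.cS (T z) := by
    intro z hz
    have hw : (2 / ρ') • z ∈ closedBall (0 : EuclideanSpace ℝ (Fin 3)) 2 := by
      rw [mem_closedBall_zero_iff, norm_smul, Real.norm_of_nonneg h2ρ.le]
      rw [mem_closedBall_zero_iff] at hz
      calc 2 / ρ' * ‖z‖ ≤ 2 / ρ' * ρ' := mul_le_mul_of_nonneg_left hz h2ρ.le
        _ = 2 := by field_simp
    show Θ.toFun 1 (Λs.toFun 1 (psi.symm ((2 / ρ') • z))) = _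
    rw [hΛs_apply _ (psi_symm_ne_southPole _), psi_apply_psi_symm,
      hΛ _ hw, smul_smul, show ρ' / 2 * (2 / ρ') = 1 by field_simp, one_smul, hΘ z hz]
  have hΦ_cS : ∀ z ∈ closedBall (0 : EuclideanSpace ℝ (Fin 3)) ρ',
      Φ (E.cS (T z)) = halfTurn (psi.symm ((2 / ρ') • z)) := by
    intro z hz
    rw [hΦ_apply, ← key z hz, Diffeomorph.symm_apply_apply, Diffeomorph.symm_apply_apply]
  -- (K3) a point off `cS (T (B̄(0, ρ')))` is carried into the open northern hemisphere
  have north : ∀ y : sphere (0 : EuclideanSpace ℝ (Fin 4)) 1,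
      (∀ z ∈ closedBall (0 : EuclideanSpace ℝ (Fin 3)) ρ', y ≠ E.cS (T z)) →
      0 < ((Φ y : sphere (0 : EuclideanSpace ℝ (Fin 4)) 1) : EuclideanSpace ℝ (Fin 4)) (Fin.last 3) := by
    intro y hy
    rw [hΦ_apply, halfTurn_apply_last, neg_pos]
    by_contra hge
    push Not at hge
    set q := ΛD.symm (ΘD.symm y) with hq
    obtain ⟨hq1, hq2⟩ := eq_psi_symm_of_last_nonneg hge
    set z := (ρ' / 2) • psi q with hz
    have hzb : z ∈ closedBall (0 : EuclideanSpace ℝ (Fin 3)) ρ' := by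
      rw [mem_closedBall_zero_iff, hz, norm_smul, Real.norm_of_nonneg (by positivity)]
      calc ρ' / 2 * ‖psi q‖ ≤ ρ' / 2 * 2 := mul_le_mul_of_nonneg_left hq2 (by positivity)
        _ = ρ' := by ring
    have hzq : (2 / ρ') • z = psi q := by
      rw [hz, smul_smul, show 2 / ρ' * (ρ' / 2) = 1 by field_simp, one_smul]
    apply hy z hzb
    rw [← key z hzb, hzq, ← hq1, hq, Diffeomorph.apply_symm_apply, Diffeomorph.apply_symm_apply]
  -- the three knots carried by `Φ`
  have hN : (Kend.map Φ).InNorth := fun x ↦ north _ (hKend x)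
  have hS : (tiny.map Φ).InSouth := by
    intro x
    rw [SphereEmbedding.map_apply, htinyT, hΦ_cS _ (ball_subset_closedBall (hKnb x)), halfTurn_apply_last,
      neg_lt_zero, psi_symm_pos_iff, norm_smul, Real.norm_of_nonneg h2ρ.le]
    have := mem_ball_zero_iff.1 (hKnb x)
    calc 2 / ρ' * ‖psi (Kn x)‖ < 2 / ρ' * ρ' := mul_lt_mul_of_pos_left this h2ρ
      _ = 2 := by field_simp
  -- isotopies: `K ≅ Φ ∘ K` for every knot, and `tiny = Θ₁ ∘ Kn`
  have hiso : ∀ K : Knot, K.IsIsotopic (K.map Φ) := by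
    intro K
    rw [hΦ, ← map_map, ← map_map]
    refine SphereEmbedding.IsIsotopic.trans_holds ?_ (((K.map ΘD.symm).map ΛD.symm).isIsotopic_map_halfTurn)
    refine SphereEmbedding.IsIsotopic.trans_holds ?_ ((isIsotopic_map_symm (K.map ΘD.symm) Λs))
    exact isIsotopic_map_symm K Θ
  have htinyΘ : tiny = Kn.map ΘD := by
    apply DFunLike.coe_injective
    funext y
    rw [SphereEmbedding.coe_map, comp_apply, hΘD, AmbientIsotopy.coe_toDiffeomorph, htinyT,
      ← hΘ _ (ball_subset_closedBall (hKnb y)), psi_symm_apply_psi (hKn y)]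
  have hKn_tiny : Kn.IsIsotopic (tiny.map Φ) := by
    refine SphereEmbedding.IsIsotopic.trans_holds ?_ (hiso tiny)
    rw [htinyΘ]; exact Kn.isIsotopic_map Θ
  -- the transported band data and the crossing condition
  obtain ⟨b', hband, hδ⟩ := h.bandData.exists_map Φ
  have hcross : b'.band ⁻¹' sphereEquator 2 ∩ squareNhd b'.δ = {x ∈ squareNhd b'.δ | x 0 = 2⁻¹} := by
    rw [hband, hδ, bandData_δ, bandData_band]
    ext x
    simp only [mem_inter_iff, mem_preimage, comp_apply, mem_setOf_eq]
    constructor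
    · rintro ⟨hx, hsq⟩
      refine ⟨hsq, (hcirc x hsq).1 ?_⟩
      -- `Φ (cS (B x))` on the equator: pull back along `key`
      rw [hΦ_apply, mem_sphereEquator_iff, halfTurn_apply_last, neg_eq_zero] at hx
      set q := ΛD.symm (ΘD.symm (E.cS (C.B x))) with hq
      obtain ⟨hq1, -⟩ := eq_psi_symm_of_last_nonneg hx.ge
      have hq2 : ‖psi q‖ = 2 := by
        rw [← psi_symm_mem_sphereEquator_iff, ← hq1]; exact (mem_sphereEquator_iff _).2 hx
      set z := (ρ' / 2) • psi q with hz
      have hzs : z ∈ sphere (0 : EuclideanSpace ℝ (Fin 3)) ρ' := by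
        rw [mem_sphere_zero_iff_norm, hz, norm_smul, Real.norm_of_nonneg (by positivity), hq2]; ring
      have hzq : (2 / ρ') • z = psi q := by
        rw [hz, smul_smul, show 2 / ρ' * (ρ' / 2) = 1 by field_simp, one_smul]
      have hkey := key z (sphere_subset_closedBall hzs)
      rw [hzq, ← hq1, hq, Diffeomorph.apply_symm_apply, Diffeomorph.apply_symm_apply] at hkey
      refine ⟨z, hzs, (E.injOn_c (hT (sphere_subset_closedBall hzs)) (h.B_mem x) ?_).symm |>.symm⟩
      simpa using
        (congrArg (fun p : sphere (0 : EuclideanSpace ℝ (Fin 4)) 1 ↦ (p : EuclideanSpace ℝ (Fin 4))) hkey).symm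
    · rintro ⟨hsq, hx0⟩
      refine ⟨?_, hsq⟩
      obtain ⟨z, hz, hzB⟩ := (hcirc x hsq).2 hx0
      rw [← hzB, hΦ_cS z (sphere_subset_closedBall hz), mem_sphereEquator_iff, halfTurn_apply_last,
        neg_eq_zero, ← mem_sphereEquator_iff, psi_symm_mem_sphereEquator_iff, norm_smul,
        Real.norm_of_nonneg h2ρ.le, mem_sphere_zero_iff_norm.1 hz]
      field_simp
  -- the normal presentation of `Φ ∘ Knew`
  exact ⟨Knew.map Φ, hiso Knew, Kend.map Φ, tiny.map Φ, hiso Kend, hKn_tiny, hN, hS, b', hcross⟩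

end BandFoliation.KnotPiece.InTube

/-! ### The carrying construction with normally presented ends -/

namespace Knot.IsConicalConcordance

open KnotsInBall StripFrame BandFoliation ChartData KnotPiece AffineIsotopy

variable {K K' : Knot} {f : (sphere (0 : EuclideanSpace ℝ (Fin 2)) 1) × ℝ → EuclideanSpace ℝ (Fin 4)} {δ : ℝ}
  (h : IsConicalConcordance K K' f δ) {w : EuclideanSpace ℝ (Fin 4)}
  {η ε : ℝ}

/-- **The carrying construction for a given model, normally presented ends.** Under the
hypotheses of `exists_isConnectedSum_isConcordant_of_model` (good tube `G`, model `md` fitting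
the tube, linearised transports `F₁`, `F₂` at the two ends), there are knots `L`, `L'` with
*normal* presentations as connected sums `K # Kn`, `K' # Kn` and a concordance `L ~ L'`: the new
end knots `N₁ ~ N₂` of the detour are isotopic to normally presented knots
(`KnotPiece.InTube.exists_isNormalConnectedSum_of_transport`), and isotopic knots are concordant
(`IsConcordant.of_isIsotopic_holds`, `equivalence_isConcordant_holds`). [cite: FoxMilnor1966, §1] -/
theorem exists_isNormalConnectedSum_isConcordant_of_model (G : (h.setup w).GoodTube 0 η ε) (md : ModelData)
    (hη1 : η ≤ 1) (hℓη : md.l * md.ℓ ≤ η / 8)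
    (hρη : 8 * md.l * md.ρ' ≤ η) (haε : 2 * md.a < ε)
    (F₁ F₂ : AmbientIsotopy 𝓘(ℝ, EuclideanSpace ℝ (Fin 3)) (EuclideanSpace ℝ (Fin 3)))
    (hF₁ : ∀ z ∈ closedBall (0 : EuclideanSpace ℝ (Fin 3)) md.ρ', F₁.toFun 1 z = h.g₁ w (md.T z)) {R₁ : ℝ}
    (hR₁ : ∀ t (y : EuclideanSpace ℝ (Fin 3)), R₁ ≤ ‖y‖ → F₁.toFun t y = y)
    (hF₂ : ∀ z ∈ closedBall (0 : EuclideanSpace ℝ (Fin 3)) md.ρ', F₂.toFun 1 z = h.g₂ w (md.T z)) {R₂ : ℝ}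
    (hR₂ : ∀ t (y : EuclideanSpace ℝ (Fin 3)), R₂ ≤ ‖y‖ → F₂.toFun t y = y)
    (hTW : ∀ z ∈ closedBall (0 : EuclideanSpace ℝ (Fin 3)) md.ρ', md.T z ∈ h.W₁ w ∩ h.W₂ w) :
    ∃ L L' : Knot, IsNormalConnectedSum K md.Kn L ∧ IsNormalConnectedSum K' md.Kn L' ∧
      L.IsConcordant L' := by
  have hρ' := md.ρ'_pos
  -- the tube fit and the detour
  have hfit : md.piece.TubeFit η ε := md.tubeFit hη1 hℓη hρη haε
  set Dt := KnotPiece.detour hfit with hDt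
  -- `T` maps the chart image of `Kn` into the region
  have hT : ∀ y, affT md.x₀ md.p md.M md.l (psi (md.Kn y)) ∈ region 0 η ε := fun y ↦
    (md.T_mem hρη haε (ball_subset_closedBall (md.psi_mem_ball y))).2.2.2
  -- the knots
  set tiny₁ := h.tinyKnot₁ (w := w) G md.hKn md.l_pos.ne' hT with htiny₁
  set tiny₂ := h.tinyKnot₂ (w := w) G md.hKn md.l_pos.ne' hT with htiny₂
  set N₁ := h.newKnot₁ Dt G with hN₁
  set N₂ := h.newKnot₂ Dt G with hN₂
  -- the two band-sum configurations
  have in₁ : md.piece.InTube (h.endFrame₁ G) K tiny₁ N₁ :=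
    { fit := hfit
      lo3 := md.lo3 hℓη
      hi3 := md.hi3 hℓη
      hKend := fun u ↦ h.coe_K_circlePt u
      htiny := fun θ ↦ by
        rw [htiny₁, h.coe_tinyKnot₁, endFrame₁_c, ModelData.piece_k, ModelData.k_apply]; rfl
      hKnew := fun u ↦ by
        rw [hN₁, circlePt_eq_circlePoint, h.coe_newKnot₁_circlePoint, mul_div_cancel_left₀ _ (by positivity),
          endFrame₁_c]
        rfl
      separated := fun x hx hd u he' ↦ h.separated₁ G x hx hd u he'
      clean := md.clean }
  have in₂ : md.piece.InTube (h.endFrame₂ G) K' tiny₂ N₂ :=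
    { fit := hfit
      lo3 := md.lo3 hℓη
      hi3 := md.hi3 hℓη
      hKend := fun u ↦ h.coe_K'_circlePt u
      htiny := fun θ ↦ by
        rw [htiny₂, h.coe_tinyKnot₂, endFrame₂_c, ModelData.piece_k, ModelData.k_apply]; rfl
      hKnew := fun u ↦ by
        rw [hN₂, circlePt_eq_circlePoint, h.coe_newKnot₂_circlePoint, mul_div_cancel_left₀ _ (by positivity),
          endFrame₂_c]
        rfl
      separated := fun x hx hd u he' ↦ h.separated₂ G x hx hd u he'
      clean := md.clean }
  -- the transported isotopies on `𝕊³`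
  set Θ₁ := F₁.alongChart (φ := psi) contMDiffOn_psi contMDiff_psi_symm psi_target hR₁ with hΘ₁
  set Θ₂ := F₂.alongChart (φ := psi) contMDiffOn_psi contMDiff_psi_symm psi_target hR₂ with hΘ₂
  have hΘ₁' : ∀ z ∈ closedBall (0 : EuclideanSpace ℝ (Fin 3)) md.ρ',
      Θ₁.toFun 1 (psi.symm z) = (h.endFrame₁ G).cS (md.T z) := by
    intro z hz
    rw [hΘ₁, AmbientIsotopy.alongChart_toFun, chartTransport_of_mem _ (mem_psi_source (psi_symm_ne_southPole z)),
      psi_apply_psi_symm, hF₁ z hz, endFrame₁_cS]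
    exact psi_symm_apply_psi (hTW z hz).1
  have hΘ₂' : ∀ z ∈ closedBall (0 : EuclideanSpace ℝ (Fin 3)) md.ρ',
      Θ₂.toFun 1 (psi.symm z) = (h.endFrame₂ G).cS (md.T z) := by
    intro z hz
    rw [hΘ₂, AmbientIsotopy.alongChart_toFun, chartTransport_of_mem _ (mem_psi_source (psi_symm_ne_southPole z)),
      psi_apply_psi_symm, hF₂ z hz, endFrame₂_cS]
    exact psi_symm_apply_psi (hTW z hz).2
  have hTmaps : MapsTo md.T (closedBall (0 : EuclideanSpace ℝ (Fin 3)) md.ρ') (region 0 η ε) := fun z hz ↦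
    (md.T_mem hρη haε hz).2.2.2
  -- the normal presentations
  have hsum₁ : ∃ N₀, N₁.IsIsotopic N₀ ∧ IsNormalConnectedSum K md.Kn N₀ := by
    refine in₁.exists_isNormalConnectedSum_of_transport md.hKn md.T hρ' Θ₁ hΘ₁' hTmaps (fun y ↦ ?_)
      md.psi_mem_ball (fun y z hz heq ↦ ?_) (fun x hx ↦ md.B_mem_image_iff hx)
    · apply Subtype.ext; rw [htiny₁, h.coe_tinyKnot₁, endFrame₁_cS, coe_cS₁]; rfl
    · obtain ⟨v, -, rfl⟩ := InTube.exists_window (C := md.chart) y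
      obtain ⟨h0, hd, hpos, -⟩ := md.T_mem hρη haε hz
      have := (in₁.separated (md.T z) h0 hd v (by rw [heq]; rfl)).1
      linarith
  have hsum₂ : ∃ N₀, N₂.IsIsotopic N₀ ∧ IsNormalConnectedSum K' md.Kn N₀ := by
    refine in₂.exists_isNormalConnectedSum_of_transport md.hKn md.T hρ' Θ₂ hΘ₂' hTmaps (fun y ↦ ?_)
      md.psi_mem_ball (fun y z hz heq ↦ ?_) (fun x hx ↦ md.B_mem_image_iff hx)
    · apply Subtype.ext; rw [htiny₂, h.coe_tinyKnot₂, endFrame₂_cS, coe_cS₂]; rfl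
    · obtain ⟨v, -, rfl⟩ := InTube.exists_window (C := md.chart) y
      obtain ⟨h0, hd, hpos, -⟩ := md.T_mem hρη haε hz
      have := (in₂.separated (md.T z) h0 hd v (by rw [heq]; rfl)).1
      linarith
  -- isotopic knots are concordant: pass from `N₁ ~ N₂` to the normally presented copies
  obtain ⟨L, hL, hLn⟩ := hsum₁
  obtain ⟨L', hL', hL'n⟩ := hsum₂
  have hc : N₁.IsConcordant N₂ := ⟨_, h.isConcordance_newAnnulus Dt G⟩
  exact ⟨L, L', hLn, hL'n, equivalence_isConcordant_holds.trans
    (equivalence_isConcordant_holds.symm (IsConcordant.of_isIsotopic_holds hL))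
    (equivalence_isConcordant_holds.trans hc (IsConcordant.of_isIsotopic_holds hL'))⟩

/-- **Fox–Milnor's carrying construction, normally presented ends.** Given a conical concordance
from `K` to `K'` with a good tube along `θ = 0` and any knot `K₂`, there are knots `L`, `L'`
with normal presentations as connected sums `K # K₂`, `K' # K₂` and a concordance `L ~ L'` (same
choices as `exists_isConnectedSum_isConcordant`: flat arc, height, frame, scale, collar width;
then `exists_isNormalConnectedSum_isConcordant_of_model`). [cite: FoxMilnor1966, §1] -/
theorem exists_isNormalConnectedSum_isConcordant (G : (h.setup w).GoodTube 0 η ε) (K₂ : Knot) :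
    ∃ L L' : Knot, IsNormalConnectedSum K K₂ L ∧ IsNormalConnectedSum K' K₂ L' ∧
      L.IsConcordant L' := by
  have hε := G.ε_pos
  have hη := G.η_pos
  have hη4 := G.η_le
  -- the flat arc of the second summand
  obtain ⟨Kn, hK₂Kn, hKn, p, e, ℓ, ν, he, he2, hℓ, hν, hlow, hbox, α, θ₁, β, σ, hαθ, hθβ, hβ, hσ, hσ',
    -, hσα, hσβ, hseg⟩ := K₂.exists_flatArc_param
  -- a bound of the second summand in the chart
  obtain ⟨Rb, hRb⟩ : ∃ Rb : ℝ, ∀ y, ‖psi (Kn y)‖ ≤ Rb := by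
    obtain ⟨R, hR⟩ := (isCompact_range (Knot.contMDiff_psi_comp hKn).continuous).isBounded.exists_norm_le
    exact ⟨R, fun y ↦ hR _ ⟨y, rfl⟩⟩
  have hRb0 : 0 ≤ Rb := le_trans (norm_nonneg _) (hRb (circlePoint 0))
  have hρ'pos : 0 < Rb + 1 := by linarith
  -- the height of the band
  obtain ⟨a, ha, hx₁, hx₂⟩ := h.exists_height G
  have ha0 : 0 < a := by linarith [ha.1]
  have hx₀reg : (a • e3 1 : EuclideanSpace ℝ (Fin 3)) ∈ region 0 η ε := by
    refine ⟨by simp [hη], ?_⟩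
    simp only [PiLp.smul_apply, e3_apply, smul_eq_mul]
    simp
    rw [abs_of_pos ha0]; linarith [ha.2]
  -- the frame, oriented compatibly with the lower end chart
  obtain ⟨s, hs, hdet⟩ := exists_frameOf_det_pos (equivOfInjective _ (h.injective_fderiv_g₁ G hx₀reg hx₁)) he he2
  rw [coe_equivOfInjective] at hdet
  -- the two linearised transports on the model ball
  have hWo : IsOpen (region 0 η ε ∩ (h.W₁ w ∩ h.W₂ w)) :=
    (isOpen_region 0 η ε).inter ((h.isOpen_W₁ w).inter (h.isOpen_W₂ w))
  have hxW : (a • e3 1 : EuclideanSpace ℝ (Fin 3)) ∈ region 0 η ε ∩ (h.W₁ w ∩ h.W₂ w) := ⟨hx₀reg, hx₁, hx₂⟩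
  have hg₁ : ContDiffOn ℝ ∞ (h.g₁ w) (region 0 η ε ∩ (h.W₁ w ∩ h.W₂ w)) :=
    (h.contDiffOn_g₁ w).mono fun x hx ↦ hx.2.1
  have hg₂ : ContDiffOn ℝ ∞ (h.g₂ w) (region 0 η ε ∩ (h.W₁ w ∩ h.W₂ w)) :=
    (h.contDiffOn_g₂ w).mono fun x hx ↦ hx.2.2
  have hL₁' : HasFDerivAt (h.g₁ w)
      (equivOfInjective _ (h.injective_fderiv_g₁ G hx₀reg hx₁) :
        EuclideanSpace ℝ (Fin 3) →L[ℝ] EuclideanSpace ℝ (Fin 3)) (a • e3 1) := by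
    rw [coe_equivOfInjective]; exact (h.differentiableAt_g₁ hx₁).hasFDerivAt
  have hL₂' : HasFDerivAt (h.g₂ w)
      (equivOfInjective _ (h.injective_fderiv_g₂ G hx₀reg hx₂) :
        EuclideanSpace ℝ (Fin 3) →L[ℝ] EuclideanSpace ℝ (Fin 3)) (a • e3 1) := by
    rw [coe_equivOfInjective]; exact (h.differentiableAt_g₂ hx₂).hasFDerivAt
  have hM₁ : 0 < (toMat ((equivOfInjective _ (h.injective_fderiv_g₁ G hx₀reg hx₁) :
      EuclideanSpace ℝ (Fin 3) →L[ℝ] EuclideanSpace ℝ (Fin 3)).comp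
      (frameOf he he2 hs : EuclideanSpace ℝ (Fin 3) →L[ℝ] EuclideanSpace ℝ (Fin 3)))).det := by
    rw [coe_equivOfInjective]; exact hdet
  have hM₂ : 0 < (toMat ((equivOfInjective _ (h.injective_fderiv_g₂ G hx₀reg hx₂) :
      EuclideanSpace ℝ (Fin 3) →L[ℝ] EuclideanSpace ℝ (Fin 3)).comp
      (frameOf he he2 hs : EuclideanSpace ℝ (Fin 3) →L[ℝ] EuclideanSpace ℝ (Fin 3)))).det := by
    rw [coe_equivOfInjective]; exact h.det_toMat_comp_pos G hx₀reg hx₁ hx₂ _ hdet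
  have hZc : IsCompact (closedBall (0 : EuclideanSpace ℝ (Fin 3)) (Rb + 1)) := isCompact_closedBall _ _
  obtain ⟨l₁, hl₁, H₁⟩ := exists_ambientIsotopy_comp_affine hWo hg₁ hxW _ _ hL₁' hM₁ hZc p
  obtain ⟨l₂, hl₂, H₂⟩ := exists_ambientIsotopy_comp_affine hWo hg₂ hxW _ _ hL₂' hM₂ hZc p
  -- the scale
  obtain ⟨l, hlpos, hll₁, hll₂, hl_a, hl_η, hl_ℓ⟩ : ∃ l : ℝ, 0 < l ∧ l < l₁ ∧ l < l₂ ∧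
      16 * l * (Rb + 1) ≤ a ∧ 8 * l * (Rb + 1) ≤ η ∧ l * ℓ ≤ η / 8 := by
    refine ⟨min (min l₁ l₂ / 2) (min (a / (16 * (Rb + 1))) (min (η / (8 * (Rb + 1))) (η / (8 * ℓ)))),
      lt_min (by positivity) (lt_min (by positivity) (lt_min (by positivity) (by positivity))), ?_, ?_, ?_, ?_, ?_⟩
    · have h1 : min (min l₁ l₂ / 2) (min (a / (16 * (Rb + 1))) (min (η / (8 * (Rb + 1))) (η / (8 * ℓ)))) ≤
        min l₁ l₂ / 2 := min_le_left _ _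
      have := min_le_left l₁ l₂; linarith
    · have h1 : min (min l₁ l₂ / 2) (min (a / (16 * (Rb + 1))) (min (η / (8 * (Rb + 1))) (η / (8 * ℓ)))) ≤
        min l₁ l₂ / 2 := min_le_left _ _
      have := min_le_right l₁ l₂; linarith
    · have h1 : min (min l₁ l₂ / 2) (min (a / (16 * (Rb + 1))) (min (η / (8 * (Rb + 1))) (η / (8 * ℓ)))) ≤
        a / (16 * (Rb + 1)) := (min_le_right _ _).trans (min_le_left _ _)
      rw [le_div_iff₀ (by positivity)] at h1; linarith
    · have h1 : min (min l₁ l₂ / 2) (min (a / (16 * (Rb + 1))) (min (η / (8 * (Rb + 1))) (η / (8 * ℓ)))) ≤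
        η / (8 * (Rb + 1)) := ((min_le_right _ _).trans (min_le_right _ _)).trans (min_le_left _ _)
      rw [le_div_iff₀ (by positivity)] at h1; linarith
    · have h1 : min (min l₁ l₂ / 2) (min (a / (16 * (Rb + 1))) (min (η / (8 * (Rb + 1))) (η / (8 * ℓ)))) ≤
        η / (8 * ℓ) := ((min_le_right _ _).trans (min_le_right _ _)).trans (min_le_right _ _)
      rw [le_div_iff₀ (by positivity)] at h1; linarith
  obtain ⟨hTW, F₁, hF₁, R₁, hR₁⟩ := H₁ l ⟨hlpos, hll₁⟩
  obtain ⟨-, F₂, hF₂, R₂, hR₂⟩ := H₂ l ⟨hlpos, hll₂⟩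
  -- the collar width
  obtain ⟨δ', hδ'pos, hδ'le, hδ'room, hδ'up, hδ'clean⟩ : ∃ δ' : ℝ, 0 < δ' ∧ δ' ≤ 1 / 8 ∧
      δ' * (16 * a * (Rb + 1)) ≤ l ∧ δ' * (16 * (Rb + 1) ^ 2) < 1 ∧ δ' * (2 * a) ≤ l * ν := by
    refine ⟨min (1 / 8) (min (l / (16 * a * (Rb + 1))) (min (1 / (32 * (Rb + 1) ^ 2)) (l * ν / (2 * a)))),
      lt_min (by norm_num) (lt_min (by positivity) (lt_min (by positivity) (by positivity))), min_le_left _ _,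
      ?_, ?_, ?_⟩
    · have h1 : min (1 / 8) (min (l / (16 * a * (Rb + 1))) (min (1 / (32 * (Rb + 1) ^ 2)) (l * ν / (2 * a)))) ≤
        l / (16 * a * (Rb + 1)) := (min_le_right _ _).trans (min_le_left _ _)
      rwa [le_div_iff₀ (by positivity)] at h1
    · have h1 : min (1 / 8) (min (l / (16 * a * (Rb + 1))) (min (1 / (32 * (Rb + 1) ^ 2)) (l * ν / (2 * a)))) ≤
        1 / (32 * (Rb + 1) ^ 2) := ((min_le_right _ _).trans (min_le_right _ _)).trans (min_le_left _ _)
      rw [le_div_iff₀ (by positivity)] at h1; nlinarith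
    · have h1 : min (1 / 8) (min (l / (16 * a * (Rb + 1))) (min (1 / (32 * (Rb + 1) ^ 2)) (l * ν / (2 * a)))) ≤
        l * ν / (2 * a) := ((min_le_right _ _).trans (min_le_right _ _)).trans (min_le_right _ _)
      rwa [le_div_iff₀ (by positivity)] at h1
  -- the model
  let md : ModelData :=
    { Kn := Kn, hKn := hKn, p := p, e := e, ℓ := ℓ, ν := ν, α := α, β := β, σ := σ, norm_e := he,
      e_two := he2, ℓ_pos := hℓ, ν_pos := hν, lowest := hlow, box := hbox, α_lt_β := hαθ.trans hθβ,
      β_lt := hβ, contDiff_σ := hσ, deriv_σ_pos := hσ', σ_α := hσα, σ_β := hσβ, seg := hseg, Rb := Rb,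
      ρ' := Rb + 1, norm_le := hRb, ρ'_ge := le_rfl, M := frameOf he he2 hs, M_zero := frameOf_zero he he2 hs,
      M_one := frameOf_one he he2 hs, norm_M := norm_frameOf he he2 hs, a := a, l := l, δ := δ',
      a_pos := ha0, l_pos := hlpos, δ_pos := hδ'pos, δ_le := hδ'le, l_le := hl_a, δ_room := hδ'room,
      δ_up := hδ'up, δ_clean := hδ'clean }
  have hmdT : ∀ z, md.T z = a • e3 1 + l • frameOf he he2 hs (z - p) := fun z ↦ rfl
  obtain ⟨L, L', hL, hL', hc⟩ := h.exists_isNormalConnectedSum_isConcordant_of_model G md (by linarith)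
    hl_ℓ hl_η (by linarith [ha.2]) F₁ F₂ (fun z hz ↦ by rw [hmdT]; exact hF₁ z hz) hR₁
    (fun z hz ↦ by rw [hmdT]; exact hF₂ z hz) hR₂ (fun z hz ↦ by rw [hmdT]; exact (hTW z hz).2)
  -- back to `K₂`
  refine ⟨L, L', ?_, ?_, hc⟩
  · obtain ⟨A', B', hA', hB', rest⟩ := hL
    exact ⟨A', B', hA', SphereEmbedding.IsIsotopic.trans_holds hK₂Kn hB', rest⟩
  · obtain ⟨A', B', hA', hB', rest⟩ := hL'
    exact ⟨A', B', hA', SphereEmbedding.IsIsotopic.trans_holds hK₂Kn hB', rest⟩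

end Knot.IsConicalConcordance

/-! ### Normal presentations: factors up to isotopy, exchange of the summands -/

namespace Knot

open SphereEmbedding (InNorth InSouth)

/-- A normal presentation of `K` as `K₁ # K₂` is a normal presentation as `K₁' # K₂'` for
isotopic factors (the definition quantifies over isotopic copies; transitivity and symmetry of
isotopy, `IsIsotopic.trans_holds`, `IsIsotopic.symm_holds`). [folklore] -/
theorem IsNormalConnectedSum.of_isIsotopic {K₁ K₂ K₁' K₂' K : Knot}
    (h : IsNormalConnectedSum K₁ K₂ K) (h₁ : K₁.IsIsotopic K₁') (h₂ : K₂.IsIsotopic K₂') :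
    IsNormalConnectedSum K₁' K₂' K := by
  obtain ⟨A, B, hA, hB, rest⟩ := h
  exact ⟨A, B, SphereEmbedding.IsIsotopic.trans_holds (SphereEmbedding.IsIsotopic.symm_holds h₁) hA,
    SphereEmbedding.IsIsotopic.trans_holds (SphereEmbedding.IsIsotopic.symm_holds h₂) hB, rest⟩

/-- **Exchange of the summands of a normal presentation.** If `K` has a normal presentation as
`K₁ # K₂` (copy `A` of `K₁` in the north, `B` of `K₂` in the south), then `rot_π ∘ K` has a normal
presentation as `K₂ # K₁`: turn the band square by a half-turn (`BandData.exists_halfTurn`, which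
exchanges the summands and preserves the middle segment `{x₀ = 1/2}`), then apply the half-turn
`rot_π` of `𝕊³` (`halfTurn`: isotopic to the identity, exchanging the hemispheres and preserving
the equator). Cromwell (2004), §4.6. [folklore] -/
theorem IsNormalConnectedSum.swap {K₁ K₂ K : Knot} (h : IsNormalConnectedSum K₁ K₂ K) :
    IsNormalConnectedSum K₂ K₁ (K.map halfTurn) := by
  obtain ⟨A, B, hA, hB, hAN, hBS, b, hcross⟩ := h
  -- knots in opposite open hemispheres are disjoint (cf. `disjoint_range_of_inNorth_inSouth`,
  -- `SchubertNormalForm.lean`, not imported here)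
  have hdisj : Disjoint (range A) (range B) := by
    rw [Set.disjoint_left]
    rintro _ ⟨x, rfl⟩ ⟨y, hy⟩
    have h₁ := hAN x
    have h₂ := hBS y
    rw [hy] at h₂
    exact lt_asymm h₁ h₂
  obtain ⟨b', hδ', hband'⟩ := b.exists_halfTurn hdisj
  -- the half-turned band crosses the equator in the same middle segment
  have hcross' : b'.band ⁻¹' sphereEquator 2 ∩ squareNhd b'.δ = {x ∈ squareNhd b'.δ | x 0 = 2⁻¹} := by
    rw [hband', hδ']
    ext x
    have hx := Set.ext_iff.mp hcross (pt2 1 1 - x)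
    simp only [mem_inter_iff, mem_preimage, mem_setOf_eq, pt2_one_one_sub_mem_squareNhd_iff,
      pt2_one_one_sub_apply] at hx ⊢
    rw [hx]
    exact and_congr_right fun _ ↦ ⟨fun h ↦ by linarith, fun h ↦ by linarith⟩
  -- transport by the half-turn of `𝕊³`
  obtain ⟨b'', hband'', hδ''⟩ := b'.exists_map halfTurn
  refine ⟨B.map halfTurn, A.map halfTurn,
    SphereEmbedding.IsIsotopic.trans_holds hB (B.isIsotopic_map_halfTurn),
    SphereEmbedding.IsIsotopic.trans_holds hA (A.isIsotopic_map_halfTurn),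
    hBS.map_halfTurn, hAN.map_halfTurn, b'', ?_⟩
  rw [hband'', hδ'', ← halfTurn_image_sphereEquator, Set.preimage_comp,
    Set.preimage_image_eq _ (show Injective ⇑halfTurn from halfTurn.injective)]
  exact hcross'

/-! ### The one-sided facts with normal presentations -/

/-- **Connected sum of a concordance with a fixed knot (first factor), normal presentations.**
If `K₁ ~ K₁'` are concordant then for every knot `K₂` there are knots `K`, `K'` with normal
presentations as `K₁ # K₂`, `K₁' # K₂` and `K ~ K'`: straighten the concordance to a conical one
(`IsConcordance.exists_conical`), take a good tube along an arc
(`IsConicalConcordance.exists_goodTube`) and carry a small copy of `K₂` along it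
(`IsConicalConcordance.exists_isNormalConnectedSum_isConcordant`). Fox–Milnor (1966), §1;
Livingston (2005), Thm. 2.2. [cite: FoxMilnor1966, §1] -/
theorem exists_isNormalConnectedSum_isConcordant_left {K₁ K₁' : Knot} (K₂ : Knot)
    (hc : K₁.IsConcordant K₁') :
    ∃ K K' : Knot, IsNormalConnectedSum K₁ K₂ K ∧ IsNormalConnectedSum K₁' K₂ K' ∧
      K.IsConcordant K' := by
  obtain ⟨f₀, hf₀⟩ := hc
  obtain ⟨f, hf, δ, hδ, hδ4, hc₁, hc₂⟩ := hf₀.exists_conical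
  have h : IsConicalConcordance K₁ K₁' f δ := ⟨hf, hδ, hδ4, hc₁, hc₂⟩
  obtain ⟨w, η, ε, G⟩ := h.exists_goodTube 0
  exact h.exists_isNormalConnectedSum_isConcordant G K₂

/-- **Connected sum of a fixed knot with a concordance (second factor), normal presentations**:
from the first-factor version by exchanging the summands (`IsNormalConnectedSum.swap`; the
half-turned knots are isotopic to the original ones, hence concordant,
`IsConcordant.of_isIsotopic_holds`). [cite: FoxMilnor1966, §1] -/
theorem exists_isNormalConnectedSum_isConcordant_right (K₁ : Knot) {K₂ K₂' : Knot}
    (hc : K₂.IsConcordant K₂') :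
    ∃ K K' : Knot, IsNormalConnectedSum K₁ K₂ K ∧ IsNormalConnectedSum K₁ K₂' K' ∧
      K.IsConcordant K' := by
  obtain ⟨P, P', hP, hP', hc'⟩ := exists_isNormalConnectedSum_isConcordant_left K₁ hc
  refine ⟨P.map halfTurn, P'.map halfTurn, hP.swap, hP'.swap, ?_⟩
  exact equivalence_isConcordant_holds.trans
    (equivalence_isConcordant_holds.symm (IsConcordant.of_isIsotopic_holds (P.isIsotopic_map_halfTurn)))
    (equivalence_isConcordant_holds.trans hc' (IsConcordant.of_isIsotopic_holds (P'.isIsotopic_map_halfTurn)))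

/-! ### Assembly -/

/-- **Two normal presentations with isotopic summands give isotopic knots**, granted Schubert's
theorem in normal position (`hH`): match the summands of the second presentation to those of the
first by the knots-in-a-ball theorem (`IsNormalConnectedSum.exists_bandData_eq`), then apply
`hH` to the two band sums of the same northern and southern knots. Cromwell (2004), §4.6.
[cite: Cromwell2004, §4.6 (PDF p. 69)] -/
theorem IsNormalConnectedSum.isIsotopic_of_normalPosition (hH : Schubert1949_normalPosition)
    {K₁ K₂ L L' : Knot} (hL : IsNormalConnectedSum K₁ K₂ L) (hL' : IsNormalConnectedSum K₁ K₂ L') :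
    L.IsIsotopic L' := by
  obtain ⟨A, B, hA, hB, hAN, hBS, b, hcross⟩ := hL
  obtain ⟨L'', hL'L'', b'', hcross''⟩ := hL'.exists_bandData_eq hA hB hAN hBS
  exact IsAmbientIsotopic.trans_holds (hH b b'' hAN hBS hcross hcross'')
    (IsAmbientIsotopic.symm_holds hL'L'')

/-- **The connected sum of concordances from Schubert's theorem in normal position.** The named
fact `Knot.exists_isConnectedSum_isConcordant` (`BandSumConcordance.lean`) follows from
`Schubert1949_normalPosition` alone: if `K₁ ~ K₁'` and `K₂ ~ K₂'`, chain
`K₁ # K₂ ~ K₁' # K₂` (`exists_isNormalConnectedSum_isConcordant_left`), the isotopy between the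
two normally presented witnesses of `K₁' # K₂` (`IsNormalConnectedSum.isIsotopic_of_normalPosition`,
isotopic knots being concordant) and `K₁' # K₂ ~ K₁' # K₂'`
(`exists_isNormalConnectedSum_isConcordant_right`); normal presentations are presentations
(`IsNormalConnectedSum.isConnectedSum`). Fox–Milnor (1966), §1; Livingston (2005), Thm. 2.2.
[cite: FoxMilnor1966, §1] -/
theorem exists_isConnectedSum_isConcordant_of_normalPosition (hH : Schubert1949_normalPosition) :
    exists_isConnectedSum_isConcordant := by
  intro K₁ K₂ K₁' K₂' h₁ h₂
  obtain ⟨L, L', hL, hL', hc⟩ := exists_isNormalConnectedSum_isConcordant_left K₂ h₁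
  obtain ⟨M, M', hM, hM', hc'⟩ := exists_isNormalConnectedSum_isConcordant_right K₁' h₂
  have hmid : L'.IsConcordant M :=
    IsConcordant.of_isIsotopic_holds (hL'.isIsotopic_of_normalPosition hH hM)
  exact ⟨L, M', hL.isConnectedSum, hM'.isConnectedSum,
    equivalence_isConcordant_holds.trans hc (equivalence_isConcordant_holds.trans hmid hc')⟩

end Knot

end Literature.Topology.FourManifolds
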